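import Mathlib
import Summits.ValiantsHypothesis.ValiantsHypothesis.Theses.LiouvilleSarnak
import Summits.ValiantsHypothesis.ValiantsHypothesis.Theorems.LiouvilleSarnakDigitalBilinearLiouvilleTtStarShortShifts

/-!
# Route LiouvilleSarnak — crux `DigitalBilinearLiouville` (stmt-ValiantsHypothesis-14774), line
# `tt_star`: DOUBLE differencing — the two-point stub from SHORT DIGITAL BOXES (four-point sums
# with a fixed short column flip AND a fixed short row flip, over ALL base points)

`…TtStarShortShifts.lean` (p828002) removed the long COLUMN shifts from the open stub
`stub_twoPointDigital`: at level `n = k + m`,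
`S(π) ≤ 16^n/2^k + 2^m Σ_t Σ_{i≠j} (Σ_r λ(m_{r,(i,t)}) λ(m_{r,(j,t)}))²`.  The surviving inner sums
`Σ_r` run over ALL rows, and their squares are four-point sums over all PAIRS of rows `(r, r')`, i.e.
over row shifts up to the range.  This file differences once more, in the ROW variable
(`r = Fin.append ρ s`, low row bits `ρ : Fin k → Bool`, high row bits `s : Fin m → Bool`):

* §1 `sq_sum_le_card_mul_boxSum` — `(Σ_{(ρ,s)} f(ρ,s))² ≤ |β| Σ_s Σ_{ρ,ρ'} f(ρ,s) f(ρ',s)`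
  (Cauchy–Schwarz over the high row bits).
* §2 ★ `twoPoint_le_shortBoxes` — for EVERY cut `π` at level `k + m`:
  `S(π) ≤ 4^m · Σ_{i,j} Σ_{ρ,ρ'} B_π(i,j;ρ,ρ')`, where
  `B_π(i,j;ρ,ρ') = Σ_{t,s} λ(m_{(ρ,s),(i,t)}) λ(m_{(ρ,s),(j,t)}) λ(m_{(ρ',s),(i,t)}) λ(m_{(ρ',s),(j,t)})`
  is the sum of `λ` over the `4^m` DIGITAL BOXES with the FIXED column flip `i → j` (low `k` column
  bits) and the FIXED row flip `ρ → ρ'` (low `k` row bits), the base point `(s, t)` ranging over ALL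
  assignments of the high row and column bits.  The degenerate boxes `i = j` or `ρ = ρ'` have
  `B = 4^m` exactly and there are `< 2 · 8^k` of them: they cost `2 · 16^n / 2^k`.
* §3 ★ `twoPointDigital_of_shortBoxes` / ★ `digitalBilinearLiouville_of_shortBoxes` — hence
  `stub_twoPointDigital`, and the crux `DigitalBilinearLiouville` BY NAME, follow from
  `SDB(k)` for every `k`: for all large `m`, uniformly in the cut, every NON-degenerate short box sum
  satisfies `B_π(i,j;ρ,ρ') ≤ ε 4^m` (one-sided, `o(number of base points)`).

Why this matters (honest reading).  With both flips confined to the `k` lowest row bits and the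
`k` lowest column bits, the base point `(s,t)` runs over ALL integers `x < 4^n` with prescribed
digits at `2k` positions, and the four corners are `x + 1 + {a₁, a₂, a₃, a₄}` for four FIXED digit
patterns on those positions.  For the monotone labelling of a cut whose word has at least `k` letters
of EACH kind among its lowest `p` positions, all four `aᵢ < 2^p` and the base set is a union of
`≤ 2^p` progressions `2^p y + a`: `SDB(k)` for such cuts is the `k = 4` case of Chowla's conjecture
WITH DILATIONS in Cesàro form (`Σ_{y<Y} λ(2^p y + b₁) ⋯ λ(2^p y + b₄) = o(Y)`, distinct `bᵢ`; Tao,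
Forum Math. Pi 2016, Conj. 1.1 shape) — the SAME hypothesis under which the sibling crux
`LiouvilleCutRank` is conditionally closed in the tree
(`…LiouvilleCutRankFourPointLogChowla.liouvilleCutRank_of_chowla_dilated`, p827263).  So after this
file the part of stmt-14774 NOT covered by a mainstream conjecture is located: the cuts with a LONG
monochromatic run at the LOW positions (the aligned cut `C^n R^n` is the extreme case), where one of
the two flips is a shift of size `≍ √X` and `SDB` is a two-point statement along progressions of
modulus `2^n` (cf. `SDS` in `…TtStarShortShifts`).  Nothing here is a case of the crux;
`DigitalBilinearLiouville`, `LiouvilleCutRank`, `AlgebraicSarnak` stay OPEN; nothing bears on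
VP versus VNP.  No definitions.
-/

-- the directory `ValiantsHypothesis/ValiantsHypothesis` repeats the summit name (tree layout)
set_option linter.dupNamespace false

namespace Summit.ValiantsHypothesis.ValiantsHypothesis.Theorems.LiouvilleSarnakDigitalBilinearLiouville.TtStarShortBoxes

open Finset

open Summit.ValiantsHypothesis.ValiantsHypothesis.Theses.LiouvilleSarnak (DigitalBilinearLiouville)
open Summit.ValiantsHypothesis.ValiantsHypothesis.Theorems.LiouvilleSarnakDigitalBilinearLiouville.TtStar
  (digitalBilinearLiouville_of_twoPointDigital)
open Summit.ValiantsHypothesis.ValiantsHypothesis.Theorems.LiouvilleSarnakDigitalBilinearLiouville.TtStarShortShifts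
  (twoPoint_le_shortShifts liouville_succ_mul_self)

/-! ### §1 One more Cauchy–Schwarz: squares of full sums by same-fibre products -/

/-- **Van der Corput for a one-point sum.**  For `f : α × β → ℝ`,
`(Σ_{(ρ,s)} f(ρ,s))² ≤ |β| · Σ_s Σ_{ρ,ρ'} f(ρ,s) f(ρ',s)` (group by `s`, Cauchy–Schwarz over `s`,
expand the squares). [folklore] -/
theorem sq_sum_le_card_mul_boxSum {α β : Type*} [Fintype α] [Fintype β] (f : α × β → ℝ) :
    (∑ p, f p) ^ 2 ≤ Fintype.card β * ∑ s, ∑ ρ, ∑ ρ', f (ρ, s) * f (ρ', s) := by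
  have hsplit : ∑ p, f p = ∑ s, ∑ ρ, f (ρ, s) := by
    rw [Fintype.sum_prod_type, sum_comm]
  rw [hsplit]
  have h := sq_sum_le_card_mul_sum_sq (s := (univ : Finset β)) (f := fun s => ∑ ρ, f (ρ, s))
  simp only [Finset.card_univ] at h
  refine h.trans (le_of_eq ?_)
  congr 1
  exact sum_congr rfl fun s _ => by rw [sq, sum_mul_sum]

/-! ### §2 The cut matrices: only short digital boxes survive -/

/-- ★ **Only short digital boxes survive (quantitative, every cut).**  At level `n = k + m`, with
columns `Fin.append i t` and rows `Fin.append ρ s` (`i, ρ : Fin k → Bool` low bits,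
`t, s : Fin m → Bool` high bits):
`Σ_{r,r'} ‖Σ_c λ(m_{rc}) λ(m_{r'c})‖² ≤ 4^m · Σ_i Σ_j Σ_ρ Σ_ρ' Σ_t Σ_s λ(m_{(ρ,s),(i,t)}) λ(m_{(ρ,s),(j,t)})
λ(m_{(ρ',s),(i,t)}) λ(m_{(ρ',s),(j,t)})` — the Gram sum of the cut matrix is controlled by the sums
of `λ` over the digital boxes with a fixed column flip `i → j` and a fixed row flip `ρ → ρ'` of the
LOW bits, the base point running over all high bits.  Proof: `…TtStarShortShifts.twoPoint_le_shortShifts`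
(columns) and `sq_sum_le_card_mul_boxSum` (rows, along `Fin.appendEquiv`). [folklore] -/
theorem twoPoint_le_shortBoxes (k m : ℕ)
    (π : Fin (k + m) ⊕ Fin (k + m) ≃ Fin (2 * (k + m))) :
    (∑ r : Fin (k + m) → Bool, ∑ r' : Fin (k + m) → Bool,
      ‖∑ c : Fin (k + m) → Bool,
        ((ArithmeticFunction.liouville
            (Nat.ofBits (fun j : Fin (2 * (k + m)) => Sum.elim r c (π.symm j)) + 1) : ℤ) : ℂ) *
        ((ArithmeticFunction.liouville
            (Nat.ofBits (fun j : Fin (2 * (k + m)) => Sum.elim r' c (π.symm j)) + 1) : ℤ) : ℂ)‖ ^ 2) ≤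
    4 ^ m * ∑ i : Fin k → Bool, ∑ j : Fin k → Bool, ∑ ρ : Fin k → Bool, ∑ ρ' : Fin k → Bool,
      ∑ t : Fin m → Bool, ∑ s : Fin m → Bool,
      ((ArithmeticFunction.liouville
            (Nat.ofBits (fun l : Fin (2 * (k + m)) =>
              Sum.elim (Fin.append ρ s) (Fin.append i t) (π.symm l)) + 1) *
          ArithmeticFunction.liouville
            (Nat.ofBits (fun l : Fin (2 * (k + m)) =>
              Sum.elim (Fin.append ρ s) (Fin.append j t) (π.symm l)) + 1) *
          (ArithmeticFunction.liouville
            (Nat.ofBits (fun l : Fin (2 * (k + m)) =>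
              Sum.elim (Fin.append ρ' s) (Fin.append i t) (π.symm l)) + 1) *
          ArithmeticFunction.liouville
            (Nat.ofBits (fun l : Fin (2 * (k + m)) =>
              Sum.elim (Fin.append ρ' s) (Fin.append j t) (π.symm l)) + 1)) : ℤ) : ℝ) := by
  refine (twoPoint_le_shortShifts k m π).trans ?_
  -- the sign `f_{ijt}(r) = λ(m_{r,(i,t)}) λ(m_{r,(j,t)})`
  set f : (Fin k → Bool) → (Fin k → Bool) → (Fin m → Bool) → (Fin (k + m) → Bool) → ℝ :=
    fun i j t r =>
      ((ArithmeticFunction.liouville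
          (Nat.ofBits (fun l : Fin (2 * (k + m)) => Sum.elim r (Fin.append i t) (π.symm l)) + 1) *
        ArithmeticFunction.liouville
          (Nat.ofBits (fun l : Fin (2 * (k + m)) => Sum.elim r (Fin.append j t) (π.symm l)) + 1) :
        ℤ) : ℝ) with hf
  -- row differencing of each `(Σ_r f r)²`
  have hbox : ∀ i j t, (∑ r, f i j t r) ^ 2 ≤
      2 ^ m * ∑ s : Fin m → Bool, ∑ ρ : Fin k → Bool, ∑ ρ' : Fin k → Bool,
        f i j t (Fin.append ρ s) * f i j t (Fin.append ρ' s) := by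
    intro i j t
    rw [← (Fin.appendEquiv k m).sum_comp]
    have h := sq_sum_le_card_mul_boxSum (fun p : (Fin k → Bool) × (Fin m → Bool) =>
      f i j t (Fin.appendEquiv k m p))
    have hcard : (Fintype.card (Fin m → Bool) : ℝ) = 2 ^ m := by
      simp [Fintype.card_bool, Fintype.card_fin]
    rw [hcard] at h
    refine h.trans (le_of_eq ?_)
    rfl
  -- the summands agree: `f(ρ s) f(ρ' s)` is the four-fold product
  have hprod : ∀ i j t s ρ ρ', f i j t (Fin.append ρ s) * f i j t (Fin.append ρ' s) =
      ((ArithmeticFunction.liouville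
            (Nat.ofBits (fun l : Fin (2 * (k + m)) =>
              Sum.elim (Fin.append ρ s) (Fin.append i t) (π.symm l)) + 1) *
          ArithmeticFunction.liouville
            (Nat.ofBits (fun l : Fin (2 * (k + m)) =>
              Sum.elim (Fin.append ρ s) (Fin.append j t) (π.symm l)) + 1) *
          (ArithmeticFunction.liouville
            (Nat.ofBits (fun l : Fin (2 * (k + m)) =>
              Sum.elim (Fin.append ρ' s) (Fin.append i t) (π.symm l)) + 1) *
          ArithmeticFunction.liouville
            (Nat.ofBits (fun l : Fin (2 * (k + m)) =>
              Sum.elim (Fin.append ρ' s) (Fin.append j t) (π.symm l)) + 1)) : ℤ) : ℝ) := by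
    intro i j t s ρ ρ'
    simp only [hf]
    push_cast
    ring
  -- assemble: `2^m Σ_t Σ_i Σ_j (Σ_r f)² ≤ 2^m Σ_t Σ_i Σ_j 2^m Σ_s Σ_ρ Σ_ρ' f f`, then reorder
  calc (2 : ℝ) ^ m * ∑ t : Fin m → Bool, ∑ i : Fin k → Bool, ∑ j : Fin k → Bool, (∑ r, f i j t r) ^ 2
      ≤ 2 ^ m * ∑ t : Fin m → Bool, ∑ i : Fin k → Bool, ∑ j : Fin k → Bool,
          (2 ^ m * ∑ s : Fin m → Bool, ∑ ρ : Fin k → Bool, ∑ ρ' : Fin k → Bool,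
            f i j t (Fin.append ρ s) * f i j t (Fin.append ρ' s)) := by
        gcongr with t _ i _ j _
        exact hbox i j t
    _ = 4 ^ m * ∑ t : Fin m → Bool, ∑ i : Fin k → Bool, ∑ j : Fin k → Bool,
          ∑ s : Fin m → Bool, ∑ ρ : Fin k → Bool, ∑ ρ' : Fin k → Bool,
            f i j t (Fin.append ρ s) * f i j t (Fin.append ρ' s) := by
        simp_rw [← mul_sum]
        rw [← mul_assoc, ← mul_pow]
        norm_num
    _ = 4 ^ m * ∑ i : Fin k → Bool, ∑ j : Fin k → Bool, ∑ ρ : Fin k → Bool, ∑ ρ' : Fin k → Bool,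
          ∑ t : Fin m → Bool, ∑ s : Fin m → Bool,
            f i j t (Fin.append ρ s) * f i j t (Fin.append ρ' s) := by
        congr 1
        -- move `Σ_t` inside past `i, j`, then `Σ_s` past `ρ, ρ'`
        calc ∑ t : Fin m → Bool, ∑ i : Fin k → Bool, ∑ j : Fin k → Bool,
              ∑ s : Fin m → Bool, ∑ ρ : Fin k → Bool, ∑ ρ' : Fin k → Bool,
                f i j t (Fin.append ρ s) * f i j t (Fin.append ρ' s)
            = ∑ i : Fin k → Bool, ∑ t : Fin m → Bool, ∑ j : Fin k → Bool,
              ∑ s : Fin m → Bool, ∑ ρ : Fin k → Bool, ∑ ρ' : Fin k → Bool,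
                f i j t (Fin.append ρ s) * f i j t (Fin.append ρ' s) := sum_comm
          _ = ∑ i : Fin k → Bool, ∑ j : Fin k → Bool, ∑ t : Fin m → Bool,
              ∑ s : Fin m → Bool, ∑ ρ : Fin k → Bool, ∑ ρ' : Fin k → Bool,
                f i j t (Fin.append ρ s) * f i j t (Fin.append ρ' s) :=
              sum_congr rfl fun _ _ => sum_comm
          _ = ∑ i : Fin k → Bool, ∑ j : Fin k → Bool, ∑ ρ : Fin k → Bool, ∑ ρ' : Fin k → Bool,
              ∑ t : Fin m → Bool, ∑ s : Fin m → Bool,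
                f i j t (Fin.append ρ s) * f i j t (Fin.append ρ' s) := by
              refine sum_congr rfl fun i _ => sum_congr rfl fun j _ => ?_
              -- `Σ_t Σ_s Σ_ρ Σ_ρ' = Σ_ρ Σ_ρ' Σ_t Σ_s`
              calc ∑ t : Fin m → Bool, ∑ s : Fin m → Bool, ∑ ρ : Fin k → Bool, ∑ ρ' : Fin k → Bool,
                    f i j t (Fin.append ρ s) * f i j t (Fin.append ρ' s)
                  = ∑ t : Fin m → Bool, ∑ ρ : Fin k → Bool, ∑ ρ' : Fin k → Bool, ∑ s : Fin m → Bool,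
                    f i j t (Fin.append ρ s) * f i j t (Fin.append ρ' s) :=
                    sum_congr rfl fun _ _ => by
                      rw [sum_comm]; exact sum_congr rfl fun _ _ => sum_comm
                _ = ∑ ρ : Fin k → Bool, ∑ t : Fin m → Bool, ∑ ρ' : Fin k → Bool, ∑ s : Fin m → Bool,
                    f i j t (Fin.append ρ s) * f i j t (Fin.append ρ' s) := sum_comm
                _ = ∑ ρ : Fin k → Bool, ∑ ρ' : Fin k → Bool, ∑ t : Fin m → Bool, ∑ s : Fin m → Bool,
                    f i j t (Fin.append ρ s) * f i j t (Fin.append ρ' s) :=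
                    sum_congr rfl fun _ _ => sum_comm
    _ = _ := by
        have hsum : (∑ i : Fin k → Bool, ∑ j : Fin k → Bool, ∑ ρ : Fin k → Bool,
            ∑ ρ' : Fin k → Bool, ∑ t : Fin m → Bool, ∑ s : Fin m → Bool,
              f i j t (Fin.append ρ s) * f i j t (Fin.append ρ' s)) = _ :=
          sum_congr rfl fun i _ => sum_congr rfl fun j _ => sum_congr rfl fun ρ _ =>
            sum_congr rfl fun ρ' _ => sum_congr rfl fun t _ => sum_congr rfl fun s _ =>
              hprod i j t s ρ ρ'
        rw [hsum]


/-! ### §3 The stub and the crux from the short-box statements `SDB(k)` -/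

/-- `|λ(m+1)| = 1` as a real number. [folklore] -/
theorem abs_liouville_succ_cast (m : ℕ) :
    |((ArithmeticFunction.liouville (m + 1) : ℤ) : ℝ)| = 1 := by
  rw [ArithmeticFunction.liouville_apply (Nat.succ_ne_zero m)]
  push_cast
  rw [abs_pow, abs_neg, abs_one, one_pow]

/-- ★ **`stub_twoPointDigital` from short digital boxes.**  Suppose `SDB(k)` for every `k`: for every
`ε > 0` and all large `m`, for every cut `π` at level `k + m`, all low column patterns `i ≠ j` and all
low row patterns `ρ ≠ ρ'` (`Fin k → Bool`), the short-box sum satisfies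
`Σ_{t,s} λ(m_{(ρ,s),(i,t)}) λ(m_{(ρ,s),(j,t)}) λ(m_{(ρ',s),(i,t)}) λ(m_{(ρ',s),(j,t)}) ≤ ε · 4^m`
(one-sided; `4^m` = number of base points).  Then the open stub `stub_twoPointDigital` of line
`tt_star` holds verbatim: `twoPoint_le_shortBoxes` with `2^k ≥ 4/ε`, the `< 2 · 8^k` degenerate boxes
(`i = j` or `ρ = ρ'`, each `≤ 4^m`) costing `2 · 16^n / 2^k ≤ (ε/2) 16^n`, and `SDB(k)` at `ε/2` for
the rest. [folklore] -/
theorem twoPointDigital_of_shortBoxes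
    (hSDB : ∀ k : ℕ, ∀ ε : ℝ, 0 < ε → ∃ m₀ : ℕ, ∀ m ≥ m₀,
      ∀ π : Fin (k + m) ⊕ Fin (k + m) ≃ Fin (2 * (k + m)), ∀ i j : Fin k → Bool, i ≠ j →
        ∀ ρ ρ' : Fin k → Bool, ρ ≠ ρ' →
        ∑ t : Fin m → Bool, ∑ s : Fin m → Bool,
          ((ArithmeticFunction.liouville
                (Nat.ofBits (fun l : Fin (2 * (k + m)) =>
                  Sum.elim (Fin.append ρ s) (Fin.append i t) (π.symm l)) + 1) *
              ArithmeticFunction.liouville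
                (Nat.ofBits (fun l : Fin (2 * (k + m)) =>
                  Sum.elim (Fin.append ρ s) (Fin.append j t) (π.symm l)) + 1) *
              (ArithmeticFunction.liouville
                (Nat.ofBits (fun l : Fin (2 * (k + m)) =>
                  Sum.elim (Fin.append ρ' s) (Fin.append i t) (π.symm l)) + 1) *
              ArithmeticFunction.liouville
                (Nat.ofBits (fun l : Fin (2 * (k + m)) =>
                  Sum.elim (Fin.append ρ' s) (Fin.append j t) (π.symm l)) + 1)) : ℤ) : ℝ) ≤
          ε * 4 ^ m) :
    ∀ ε : ℝ, 0 < ε → ∃ n₀ : ℕ, ∀ n ≥ n₀, ∀ π : Fin n ⊕ Fin n ≃ Fin (2 * n),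
      (∑ r : Fin n → Bool, ∑ r' : Fin n → Bool,
        ‖∑ c : Fin n → Bool,
          ((ArithmeticFunction.liouville
              (Nat.ofBits (fun j : Fin (2 * n) => Sum.elim r c (π.symm j)) + 1) : ℤ) : ℂ) *
          ((ArithmeticFunction.liouville
              (Nat.ofBits (fun j : Fin (2 * n) => Sum.elim r' c (π.symm j)) + 1) : ℤ) : ℂ)‖ ^ 2) ≤
      ε * 16 ^ n := by
  intro ε hε
  -- choose `k` with `4 / ε ≤ 2^k`
  obtain ⟨k, hk⟩ := exists_nat_gt (4 / ε)
  have hk2 : 4 / ε ≤ (2 : ℝ) ^ k :=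
    hk.le.trans (by exact_mod_cast (Nat.lt_two_pow_self (n := k)).le)
  obtain ⟨m₀, hm₀⟩ := hSDB k (ε / 2) (by positivity)
  refine ⟨k + m₀, fun n hn π => ?_⟩
  obtain ⟨m, rfl⟩ := Nat.exists_eq_add_of_le (show k ≤ n by omega)
  have hm : m₀ ≤ m := by omega
  refine (twoPoint_le_shortBoxes k m π).trans ?_
  -- the box sums
  set T : (Fin k → Bool) → (Fin k → Bool) → (Fin k → Bool) → (Fin k → Bool) → ℝ := fun i j ρ ρ' =>
    ∑ t : Fin m → Bool, ∑ s : Fin m → Bool,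
      ((ArithmeticFunction.liouville
            (Nat.ofBits (fun l : Fin (2 * (k + m)) =>
              Sum.elim (Fin.append ρ s) (Fin.append i t) (π.symm l)) + 1) *
          ArithmeticFunction.liouville
            (Nat.ofBits (fun l : Fin (2 * (k + m)) =>
              Sum.elim (Fin.append ρ s) (Fin.append j t) (π.symm l)) + 1) *
          (ArithmeticFunction.liouville
            (Nat.ofBits (fun l : Fin (2 * (k + m)) =>
              Sum.elim (Fin.append ρ' s) (Fin.append i t) (π.symm l)) + 1) *
          ArithmeticFunction.liouville
            (Nat.ofBits (fun l : Fin (2 * (k + m)) =>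
              Sum.elim (Fin.append ρ' s) (Fin.append j t) (π.symm l)) + 1)) : ℤ) : ℝ) with hT
  change (4 : ℝ) ^ m * ∑ i, ∑ j, ∑ ρ, ∑ ρ', T i j ρ ρ' ≤ ε * 16 ^ (k + m)
  -- trivial bound: every box sum is at most the number `4^m` of base points
  have hT1 : ∀ i j ρ ρ', T i j ρ ρ' ≤ 4 ^ m := by
    intro i j ρ ρ'
    simp only [hT]
    have hterm : ∀ (a b c d : ℕ),
        (((ArithmeticFunction.liouville (a + 1) * ArithmeticFunction.liouville (b + 1) *
            (ArithmeticFunction.liouville (c + 1) * ArithmeticFunction.liouville (d + 1)) : ℤ)) : ℝ)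
          ≤ 1 := by
      intro a b c d
      refine (le_abs_self _).trans (le_of_eq ?_)
      push_cast
      rw [abs_mul, abs_mul, abs_mul, abs_liouville_succ_cast, abs_liouville_succ_cast,
        abs_liouville_succ_cast, abs_liouville_succ_cast]
      norm_num
    calc _ ≤ ∑ _t : Fin m → Bool, ∑ _s : Fin m → Bool, (1 : ℝ) :=
          sum_le_sum fun t _ => sum_le_sum fun s _ => hterm _ _ _ _
      _ = 4 ^ m := by
          simp only [sum_const, Finset.card_univ, Fintype.card_fun, Fintype.card_bool,
            Fintype.card_fin, nsmul_eq_mul, mul_one]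
          push_cast
          rw [← pow_add, show (4 : ℝ) = 2 ^ 2 by norm_num, ← pow_mul, two_mul]
  -- `SDB(k)` at `ε/2` for the non-degenerate boxes
  have hT2 : ∀ i j ρ ρ', i ≠ j → ρ ≠ ρ' → T i j ρ ρ' ≤ ε / 2 * 4 ^ m :=
    fun i j ρ ρ' hij hρ => hm₀ m hm π i j hij ρ ρ' hρ
  have h4 : (0 : ℝ) ≤ 4 ^ m := by positivity
  have hε4 : (0 : ℝ) ≤ ε / 2 * 4 ^ m := by positivity
  have hcardk : ((Finset.univ : Finset (Fin k → Bool)).card : ℝ) = 2 ^ k := by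
    simp [Fintype.card_bool, Fintype.card_fin]
  -- inner sums over `ρ, ρ'` for `j ≠ i`
  have hU : ∀ i j, i ≠ j → ∑ ρ, ∑ ρ', T i j ρ ρ' ≤ 2 ^ k * (4 ^ m + 2 ^ k * (ε / 2 * 4 ^ m)) := by
    intro i j hij
    have hρ : ∀ ρ : Fin k → Bool, ∑ ρ', T i j ρ ρ' ≤ 4 ^ m + 2 ^ k * (ε / 2 * 4 ^ m) := by
      intro ρ
      rw [← Finset.add_sum_erase _ _ (mem_univ ρ)]
      refine add_le_add (hT1 i j ρ ρ) ?_
      calc ∑ ρ' ∈ univ.erase ρ, T i j ρ ρ' ≤ ∑ ρ' ∈ univ.erase ρ, ε / 2 * 4 ^ m :=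
            sum_le_sum fun ρ' hρ' => hT2 i j ρ ρ' hij (ne_of_mem_erase hρ').symm
        _ ≤ ∑ _ρ' : Fin k → Bool, ε / 2 * 4 ^ m :=
            sum_le_sum_of_subset_of_nonneg (erase_subset _ _) fun _ _ _ => hε4
        _ = 2 ^ k * (ε / 2 * 4 ^ m) := by rw [sum_const, nsmul_eq_mul, hcardk]
    calc ∑ ρ, ∑ ρ', T i j ρ ρ' ≤ ∑ _ρ : Fin k → Bool, (4 ^ m + 2 ^ k * (ε / 2 * 4 ^ m)) :=
          sum_le_sum fun ρ _ => hρ ρ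
      _ = 2 ^ k * (4 ^ m + 2 ^ k * (ε / 2 * 4 ^ m)) := by rw [sum_const, nsmul_eq_mul, hcardk]
  -- the degenerate `j = i` boxes
  have hUdiag : ∀ i, ∑ ρ, ∑ ρ', T i i ρ ρ' ≤ 2 ^ k * (2 ^ k * 4 ^ m) := by
    intro i
    calc ∑ ρ, ∑ ρ', T i i ρ ρ' ≤ ∑ _ρ : Fin k → Bool, ∑ _ρ' : Fin k → Bool, (4 : ℝ) ^ m :=
          sum_le_sum fun ρ _ => sum_le_sum fun ρ' _ => hT1 i i ρ ρ'
      _ = 2 ^ k * (2 ^ k * 4 ^ m) := by rw [sum_const, nsmul_eq_mul, hcardk, sum_const,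
          nsmul_eq_mul, hcardk]
  -- sums over `j`, then `i`
  have hpos : (0 : ℝ) ≤ 2 ^ k * (4 ^ m + 2 ^ k * (ε / 2 * 4 ^ m)) := by positivity
  have hJ : ∀ i, ∑ j, ∑ ρ, ∑ ρ', T i j ρ ρ' ≤
      2 ^ k * (2 ^ k * 4 ^ m) + 2 ^ k * (2 ^ k * (4 ^ m + 2 ^ k * (ε / 2 * 4 ^ m))) := by
    intro i
    rw [← Finset.add_sum_erase _ _ (mem_univ i)]
    refine add_le_add (hUdiag i) ?_
    calc ∑ j ∈ univ.erase i, ∑ ρ, ∑ ρ', T i j ρ ρ'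
        ≤ ∑ j ∈ univ.erase i, 2 ^ k * (4 ^ m + 2 ^ k * (ε / 2 * 4 ^ m)) :=
          sum_le_sum fun j hj => hU i j (ne_of_mem_erase hj).symm
      _ ≤ ∑ _j : Fin k → Bool, 2 ^ k * (4 ^ m + 2 ^ k * (ε / 2 * 4 ^ m)) :=
          sum_le_sum_of_subset_of_nonneg (erase_subset _ _) fun _ _ _ => hpos
      _ = 2 ^ k * (2 ^ k * (4 ^ m + 2 ^ k * (ε / 2 * 4 ^ m))) := by
          rw [sum_const, nsmul_eq_mul, hcardk]
  have hI : ∑ i, ∑ j, ∑ ρ, ∑ ρ', T i j ρ ρ' ≤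
      2 ^ k * (2 ^ k * (2 ^ k * 4 ^ m) + 2 ^ k * (2 ^ k * (4 ^ m + 2 ^ k * (ε / 2 * 4 ^ m)))) := by
    calc ∑ i, ∑ j, ∑ ρ, ∑ ρ', T i j ρ ρ'
        ≤ ∑ _i : Fin k → Bool,
            (2 ^ k * (2 ^ k * 4 ^ m) + 2 ^ k * (2 ^ k * (4 ^ m + 2 ^ k * (ε / 2 * 4 ^ m)))) :=
          sum_le_sum fun i _ => hJ i
      _ = _ := by rw [sum_const, nsmul_eq_mul, hcardk]
  -- arithmetic: `4^m · 2^k (8^k 4^m · 2 + 8^k (ε/2) 4^m) = 2 · 16^n / 2^k + (ε/2) 16^n ≤ ε 16^n`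
  have h16 : (16 : ℝ) ^ (k + m) = 2 ^ k * (4 ^ m * (2 ^ k * (2 ^ k * (2 ^ k * 4 ^ m)))) := by
    rw [show (16 : ℝ) = 2 ^ 4 by norm_num, show (4 : ℝ) = 2 ^ 2 by norm_num]
    simp only [← pow_mul, ← pow_add]
    congr 1
    ring
  have hkε : (4 : ℝ) ≤ ε * 2 ^ k := by
    have := (div_le_iff₀ hε).mp hk2
    linarith
  calc (4 : ℝ) ^ m * ∑ i, ∑ j, ∑ ρ, ∑ ρ', T i j ρ ρ'
      ≤ 4 ^ m * (2 ^ k * (2 ^ k * (2 ^ k * 4 ^ m) +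
          2 ^ k * (2 ^ k * (4 ^ m + 2 ^ k * (ε / 2 * 4 ^ m))))) := by gcongr
    _ = 2 * (4 ^ m * (2 ^ k * (2 ^ k * (2 ^ k * 4 ^ m)))) +
          ε / 2 * (2 ^ k * (4 ^ m * (2 ^ k * (2 ^ k * (2 ^ k * 4 ^ m))))) := by ring
    _ = 2 * (4 ^ m * (2 ^ k * (2 ^ k * (2 ^ k * 4 ^ m)))) + ε / 2 * 16 ^ (k + m) := by rw [← h16]
    _ ≤ ε / 2 * 16 ^ (k + m) + ε / 2 * 16 ^ (k + m) := by
          refine add_le_add ?_ le_rfl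
          rw [h16]
          have h0 : (0 : ℝ) ≤ 4 ^ m * (2 ^ k * (2 ^ k * (2 ^ k * 4 ^ m))) := by positivity
          nlinarith
    _ = ε * 16 ^ (k + m) := by ring

/-- ★ **The crux from short digital boxes.**  The family `SDB(k)` (see
`twoPointDigital_of_shortBoxes`) implies `DigitalBilinearLiouville` (stmt-ValiantsHypothesis-14774)
BY NAME (through the landed `…TtStar.digitalBilinearLiouville_of_twoPointDigital`). [folklore] -/
theorem digitalBilinearLiouville_of_shortBoxes
    (hSDB : ∀ k : ℕ, ∀ ε : ℝ, 0 < ε → ∃ m₀ : ℕ, ∀ m ≥ m₀,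
      ∀ π : Fin (k + m) ⊕ Fin (k + m) ≃ Fin (2 * (k + m)), ∀ i j : Fin k → Bool, i ≠ j →
        ∀ ρ ρ' : Fin k → Bool, ρ ≠ ρ' →
        ∑ t : Fin m → Bool, ∑ s : Fin m → Bool,
          ((ArithmeticFunction.liouville
                (Nat.ofBits (fun l : Fin (2 * (k + m)) =>
                  Sum.elim (Fin.append ρ s) (Fin.append i t) (π.symm l)) + 1) *
              ArithmeticFunction.liouville
                (Nat.ofBits (fun l : Fin (2 * (k + m)) =>
                  Sum.elim (Fin.append ρ s) (Fin.append j t) (π.symm l)) + 1) *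
              (ArithmeticFunction.liouville
                (Nat.ofBits (fun l : Fin (2 * (k + m)) =>
                  Sum.elim (Fin.append ρ' s) (Fin.append i t) (π.symm l)) + 1) *
              ArithmeticFunction.liouville
                (Nat.ofBits (fun l : Fin (2 * (k + m)) =>
                  Sum.elim (Fin.append ρ' s) (Fin.append j t) (π.symm l)) + 1)) : ℤ) : ℝ) ≤
          ε * 4 ^ m) :
    DigitalBilinearLiouville :=
  digitalBilinearLiouville_of_twoPointDigital (twoPointDigital_of_shortBoxes hSDB)

end Summit.ValiantsHypothesis.ValiantsHypothesis.Theorems.LiouvilleSarnakDigitalBilinearLiouville.TtStarShortBoxes
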